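import Mathlib
import HarnessLib
import Literature.MathematicalPhysics.QuantumLattice.FermiRG.FST2Hypotheses
import Summits.HubbardSuperconductivity.HubbardSuperconductivity.Theorems.KLProgrammeFermiSurfaceEnvelope
import Summits.HubbardSuperconductivity.HubbardSuperconductivity.Theorems.KLProgrammeFermiSurfaceUmklapp

/-!
# Route `KLProgramme` (cruxes K3/K1): the Feldman–Salmhofer–Trubowitz II hypotheses, as TYPED in
# `FermiRG/FST2Hypotheses.lean`, instantiated at the Hubbard band on the Kohn–Luttinger window

Cell `gate-hubbard-kl`, risk-register item r2 «Fermi-surface hypotheses at `δ ∈ [0.10, 0.20]`». The typer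
file `Literature/MathematicalPhysics/QuantumLattice/FermiRG/FST2Hypotheses.lean` states FST II's hypotheses
(Sy), (A4), (A5) (and (A1)–(A3)) as predicates over a crystal datum and a band function `e` with the chemical
potential included (`S = {e = 0}`), and asserts them for no model. Here the datum is the square lattice
`FermiRG.Crystal.cubic 2` (`Γ# = 2πℤ²`, `F = [-π, π)²`) and
`e = fun p ↦ squareDispersion 1 0 p - μ = -2 (cos p₀ + cos p₁) - μ`; we PROVE, from the closed-form files
`KLProgrammeFermiSurfaceEnvelope/Umklapp/Window`:

* §1 (Sy) `FermiRG.HypSy e` for every `μ` (`klfs_hypSy`);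
* §2 (A4) `FermiRG.HypA4 (Crystal.cubic 2) e` for `-4 < μ < 0` with the antipodal map `a = (p ↦ -p)`
  (`klfs_hypA4`: `-p ∈ S ∩ F`, `n(-p) = -n(p)` since `∇e` is odd, and the left side of (upplo) vanishes —
  FST's «if `e` is symmetric, (A4) holds trivially»);
* §3 (A5) `FermiRG.HypA5 (Crystal.cubic 2) e` **holds for `-4 ≤ μ < -2`** (`klfs_hypA5_of_lt_neg_two`) and
  **fails for `-2 ≤ μ < 0`** (`klfs_not_hypA5`), in particular on the certified window
  `μ ∈ [-0.4267, -0.1798]` and on the analysis window `[-1, -0.15]` (`klfs_windows_not_hypA5`) — FST II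
  p.7: «in the Hubbard model … fulfilled for densities `n < 0.369`», here as the theorem «iff `μ < -2`».

(A1)–(A3) for the Hubbard band ((A2)/(A3) with the constants of `KLProgrammeFermiSurfaceEnvelope`) are
instantiated in the sequel file. No definitions; everything PROVED. [folklore]
-/

noncomputable section

open Real Set

-- the tree's namespace `Summit.<Summit>.<Problem>.Theorems` repeats the summit name by design (D-0017)
set_option linter.dupNamespace false

namespace Summit.HubbardSuperconductivity.HubbardSuperconductivity.Theorems

open Literature.MathematicalPhysics.QuantumLattice

/-! ### §0 Plumbing: the Hubbard band as an FST datum -/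

/-- Membership in the fundamental domain `F = [-π, π)²` of `Crystal.cubic 2`. [folklore] -/
theorem klfs_mem_cubic_fundamentalDomain {p : Momentum} :
    p ∈ (FermiRG.Crystal.cubic 2).fundamentalDomain ↔ ∀ i, -π ≤ p i ∧ p i < π := Iff.rfl

/-- Membership in FST's Fermi surface `{e = 0}` of `e = ε - μ` is `ε p = μ`. [folklore] -/
theorem klfs_mem_fermiSurface_iff {μ : ℝ} {p : Momentum} :
    p ∈ FermiRG.fermiSurface (fun q : Momentum => squareDispersion 1 0 q - μ) ↔ squareDispersion 1 0 p = μ := by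
  rw [FermiRG.mem_fermiSurface, sub_eq_zero]

/-- A point of `S ∩ F` (`-4 ≤ μ`, `μ < 0`) has all coordinates in the OPEN interval `(-π, π)` (the curve
misses the boundary of the cell, `abs_lt_pi_of_sqDispersion_eq`). [folklore] -/
theorem klfs_abs_lt_pi_of_mem_rep {μ : ℝ} (hμ : μ < 0) {p : Momentum}
    (hp : p ∈ (FermiRG.Crystal.cubic 2).fermiSurfaceRep (fun q : Momentum => squareDispersion 1 0 q - μ))
    (i : Fin 2) : |p i| < π := by
  obtain ⟨he, hF⟩ := hp
  rw [klfs_mem_fermiSurface_iff, squareDispersion_one_zero_eq_sqDispersion] at he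
  rw [klfs_mem_cubic_fundamentalDomain] at hF
  have habs : ∀ j, |(WithLp.ofLp p) j| ≤ π := fun j => abs_le.2 ⟨(hF j).1, (hF j).2.le⟩
  exact abs_lt_pi_of_sqDispersion_eq hμ habs he i

/-- The gradient of `e = ε - μ` is that of `ε`: `∇e(p) = (2 sin p₀, 2 sin p₁)`. [folklore] -/
theorem klfs_gradient_level (μ : ℝ) (p : Momentum) :
    gradient (fun q : Momentum => squareDispersion 1 0 q - μ) p = gradient (squareDispersion 1 0) p := by
  unfold gradient
  rw [fderiv_sub_const]

/-- `∇ε` is odd: `∇ε(-p) = -∇ε(p)`. [folklore] -/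
theorem klfs_gradient_neg (p : Momentum) :
    gradient (squareDispersion 1 0) (-p) = -gradient (squareDispersion 1 0) p := by
  rw [gradient_squareDispersion, gradient_squareDispersion]
  ext i
  fin_cases i <;> simp [Real.sin_neg]

/-! ### §1 (Sy) The Hubbard band is symmetric -/

/-- **(Sy) for the Hubbard band** at every level: `e(-p) = e(p)`. [folklore] -/
theorem klfs_hypSy (μ : ℝ) : FermiRG.HypSy (fun p : Momentum => squareDispersion 1 0 p - μ) := by
  intro p
  simp only [klfs_squareDispersion_neg]

/-! ### §2 (A4) holds with the antipodal map `p ↦ -p` -/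

/-- The unit normal of `e = ε - μ` is odd: `n(-p) = -n(p)`. [folklore] -/
theorem klfs_unitNormal_neg (μ : ℝ) (p : Momentum) :
    FermiRG.unitNormal (fun q : Momentum => squareDispersion 1 0 q - μ) (-p) =
      -FermiRG.unitNormal (fun q : Momentum => squareDispersion 1 0 q - μ) p := by
  simp only [FermiRG.unitNormal, klfs_gradient_level, klfs_gradient_neg, norm_neg, smul_neg]

/-- `p ↦ -p` is an antipodal map of `S ∩ F` for the Hubbard band (`μ < 0`): `-p ∈ S ∩ F` and
`n(-p) = -n(p)`. [folklore] -/
theorem klfs_isAntipodalMapOn_neg {μ : ℝ} (hμ : μ < 0) :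
    FermiRG.IsAntipodalMapOn (fun q : Momentum => squareDispersion 1 0 q - μ)
      ((FermiRG.Crystal.cubic 2).fermiSurfaceRep (fun q : Momentum => squareDispersion 1 0 q - μ))
      (fun p => -p) := by
  intro p hp
  have habs := klfs_abs_lt_pi_of_mem_rep hμ hp
  have heS : -p ∈ FermiRG.fermiSurface (fun q : Momentum => squareDispersion 1 0 q - μ) := by
    rw [klfs_mem_fermiSurface_iff, klfs_squareDispersion_neg]; exact klfs_mem_fermiSurface_iff.1 hp.1
  refine ⟨⟨heS, ?_⟩, hp.1, heS, klfs_unitNormal_neg μ p⟩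
  rw [klfs_mem_cubic_fundamentalDomain]
  intro i
  have h := abs_lt.1 (habs i)
  simp only [WithLp.ofLp_neg, Pi.neg_apply]
  constructor <;> linarith [h.1, h.2]

/-- **(A4) for the Hubbard band** (`μ < 0`): with `a(p) = -p` the left-hand side of (upplo) vanishes
(`∂(a ∘ p)/∂t = -∂p/∂t` has the same length), so `|1 - |∂p/∂t|⁻¹ |∂a(p(t))/∂t|| = 0 ≤ 1/8` — FST II
p.7: «if `e` is symmetric, (A4) holds trivially». [folklore] -/
theorem klfs_hypA4 {μ : ℝ} (hμ : μ < 0) :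
    FermiRG.HypA4 (FermiRG.Crystal.cubic 2) (fun q : Momentum => squareDispersion 1 0 q - μ) := by
  refine ⟨fun p => -p, klfs_isAntipodalMapOn_neg hμ, ?_⟩
  intro γ t γ' b _ hγ hb hγ'
  have hb' : HasDerivAt ((fun p : Momentum => -p) ∘ γ) (-γ') t := hγ.neg
  have hbeq : b = -γ' := hb.unique hb'
  rw [hbeq, norm_neg, inv_mul_cancel₀ (norm_ne_zero_iff.2 hγ')]
  norm_num

/-! ### §3 (A5) holds iff `μ < -2`: it FAILS on the window -/

/-- The open cell `(-π, π)²` is open. [folklore] -/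
theorem klfs_isOpen_openCell : IsOpen {x : Momentum | ∀ i, -π < x i ∧ x i < π} := by
  have h : {x : Momentum | ∀ i, -π < x i ∧ x i < π} = ⋂ i, (fun x : Momentum => x i) ⁻¹' Ioo (-π) π := by
    ext x; simp
  rw [h]
  exact isOpen_iInter_of_finite fun i => isOpen_Ioo.preimage (by fun_prop)

/-- The open cell lies in the interior of the fundamental domain `F = [-π, π)²` (it IS the interior; the
inclusion is what (A5) needs). [folklore] -/
theorem klfs_openCell_subset_interior :
    {x : Momentum | ∀ i, -π < x i ∧ x i < π} ⊆ interior (FermiRG.Crystal.cubic 2).fundamentalDomain :=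
  interior_maximal (fun _ hx i => ⟨(hx i).1.le, (hx i).2⟩) klfs_isOpen_openCell

/-- **(A5) HOLDS for the Hubbard band below `μ = -2`** (`-4 ≤ μ < -2`): every signed sum `u p + v q`,
`p, q ∈ S ∩ F`, `u, v = ±1`, lies in the open cell `(-π, π)² ⊆ F̊` (`klfs_A5_of_lt_neg_two`: each coordinate
is `< 2K(μ) < π`). This is FST II's «fulfilled for densities `n < 0.369`». [folklore] -/
theorem klfs_hypA5_of_lt_neg_two {μ : ℝ} (hμ₁ : -4 ≤ μ) (hμ₂ : μ < -2) :
    FermiRG.HypA5 (FermiRG.Crystal.cubic 2) (fun q : Momentum => squareDispersion 1 0 q - μ) := by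
  intro p hp q hq u v hu hv
  apply klfs_openCell_subset_interior
  have hpe : sqDispersion (WithLp.ofLp p) = μ := by
    rw [← squareDispersion_one_zero_eq_sqDispersion]; exact klfs_mem_fermiSurface_iff.1 hp.1
  have hqe : sqDispersion (WithLp.ofLp q) = μ := by
    rw [← squareDispersion_one_zero_eq_sqDispersion]; exact klfs_mem_fermiSurface_iff.1 hq.1
  have hpa : ∀ j, |(WithLp.ofLp p) j| ≤ π := fun j =>
    abs_le.2 ⟨((klfs_mem_cubic_fundamentalDomain.1 hp.2) j).1, ((klfs_mem_cubic_fundamentalDomain.1 hp.2) j).2.le⟩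
  have hqa : ∀ j, |(WithLp.ofLp q) j| ≤ π := fun j =>
    abs_le.2 ⟨((klfs_mem_cubic_fundamentalDomain.1 hq.2) j).1, ((klfs_mem_cubic_fundamentalDomain.1 hq.2) j).2.le⟩
  intro i
  have h := klfs_A5_of_lt_neg_two hμ₁ hμ₂ hpa hqa hpe hqe hu hv i
  have hcoord : (u • p + v • q) i = u * (WithLp.ofLp p) i + v * (WithLp.ofLp q) i := by simp
  rw [hcoord]
  exact abs_lt.1 h

/-- **(A5) FAILS for the Hubbard band on `[-2, 0)`**: the antinodal point `P = (K(μ), 0) ∈ S ∩ F`,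
`K(μ) = arccos (-μ/2 - 1) ≥ π/2`, has `P + P ∉ F ⊇ F̊` (first coordinate `2K(μ) ≥ π`). [folklore] -/
theorem klfs_not_hypA5 {μ : ℝ} (hμ₁ : -2 ≤ μ) (hμ₂ : μ < 0) :
    ¬ FermiRG.HypA5 (FermiRG.Crystal.cubic 2) (fun q : Momentum => squareDispersion 1 0 q - μ) := by
  intro h5
  obtain ⟨he, habs⟩ := klfs_antinode_on_curve (by linarith) hμ₂
  set P : Momentum := WithLp.toLp 2 ![umklappRadius μ, 0] with hP
  have hPrep : P ∈ (FermiRG.Crystal.cubic 2).fermiSurfaceRep (fun q : Momentum => squareDispersion 1 0 q - μ) := by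
    refine ⟨?_, ?_⟩
    · rw [klfs_mem_fermiSurface_iff, squareDispersion_one_zero_eq_sqDispersion]
      simpa [hP] using he
    · rw [klfs_mem_cubic_fundamentalDomain]
      intro i
      have h := abs_lt.1 (habs i)
      have : P i = (![umklappRadius μ, 0] : Fin 2 → ℝ) i := by simp [hP]
      rw [this]
      exact ⟨h.1.le, h.2⟩
  have hmem := h5 P hPrep P hPrep 1 1 (Or.inl rfl) (Or.inl rfl)
  have hF := (klfs_mem_cubic_fundamentalDomain.1 (interior_subset hmem) 0).2
  have hcoord : ((1 : ℝ) • P + (1 : ℝ) • P) 0 = 2 * umklappRadius μ := by simp [hP]; ring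
  rw [hcoord] at hF
  linarith [pi_div_two_le_umklappRadius hμ₁]

/-- **(A5) holds for the Hubbard band iff `μ < -2`** (levels `-4 ≤ μ < 0`). [folklore] -/
theorem klfs_hypA5_iff {μ : ℝ} (hμ₁ : -4 ≤ μ) (hμ₂ : μ < 0) :
    FermiRG.HypA5 (FermiRG.Crystal.cubic 2) (fun q : Momentum => squareDispersion 1 0 q - μ) ↔ μ < -2 := by
  constructor
  · intro h5
    by_contra hge
    exact klfs_not_hypA5 (not_lt.1 hge) hμ₂ h5
  · exact klfs_hypA5_of_lt_neg_two hμ₁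

/-- **(A5) fails on both programme windows** (`μ ∈ [-0.4267, -0.1798]`, the image of `δ ∈ [0.10, 0.20]`,
and the analysis window `[-1, -0.15]`): FST II's second-order / RPA regularity statements that use (A5)
are not available off the shelf there — the umklapp-corner lemma (crux C4b; the corners exist by
`klfs_windows_corner`) is load-bearing. [folklore] -/
theorem klfs_windows_not_hypA5 {μ : ℝ}
    (hμ : μ ∈ Icc (-0.4267 : ℝ) (-0.1798) ∨ μ ∈ Icc (-1 : ℝ) (-0.15)) :
    ¬ FermiRG.HypA5 (FermiRG.Crystal.cubic 2) (fun q : Momentum => squareDispersion 1 0 q - μ) := by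
  rcases hμ with hμ | hμ
  · exact klfs_not_hypA5 (by linarith [hμ.1]) (by linarith [hμ.2])
  · exact klfs_not_hypA5 (by linarith [hμ.1]) (by linarith [hμ.2])

end Summit.HubbardSuperconductivity.HubbardSuperconductivity.Theorems

end
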